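import Literature.MathematicalPhysics.QuantumFieldTheory.Balaban1983to89.B9Lemma21ShellCrossingZd

/-!
# `Balaban1983to89.B9GraphZdConnected` — [Balaban1984PropagatorsII] (2.46) p. 231 «admissible contours» EXIST: the block graph `graphZd L x` of a member of the [B9]
# junction's `ℤᵈ` frame is CONNECTED as soon as the blocks cover `Ω₀` (law (G1′) at level 0), lie in it (law (T)), and `Ω₀` is chain-connected through unit sup-steps —
# in particular when `Ω₀` is a box or all of `ℤᵈ`; the displayed hypothesis `∀ u v, (graphZd L x).Reachable u v` of this seat's (2.60)∕(2.61) files DISCHARGED for such members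

statement-level skeleton of published theorems with citation tags; proofs where landed; nothing here is a claim about the
Yang–Mills mass gap

PDF held: `paper:balaban1984-cmp96-propagators-rt-ii` p. 231 (2.46) «d(y, y′) … the weighted length of a shortest admissible contour joining y and y′» (a contour
joining ANY two points of 𝔅 is presupposed: the domains of print are boxes∕tori); [B9] = [Balaban1985BackgroundPropagators] p. 397 «the weighted distance d(y, y′)
defined by (2.46) in [4]».  BY NAME: the frame `B9SupplySockB9P3ZdFrame` (dag-n06-e: `graphZd`, `Touch`, `blockZd`), `B9Lemma21ShellCrossingZd` (this seat:
`blockZd_nonempty`, `Omega_antitone`).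

WHY THIS FILE (cell `pub-ymgap`, HUMAN RULING D-0062 ∕ D-0149; seat `pub-ymgap-dag-n06-w2` (g2), node N06 = [B9]; INTENT-10; count-neutral).  The frame's `distZd`
is the graph distance of `graphZd` with junk value `0` between blocks joined by no chain (g0's located (L1)); therefore (2.60) (`B9Lemma21ShellCrossingZd`), the degree∕ball
files and the member-uniform row letter (2.61) (`B9Lemma21RowLetterZd`) all DISPLAY reachability∕connectivity.  For the members anybody uses — `Ω₀` a box of `ℤᵈ`
(the finite road) or `Ω₀ = ℤᵈ` (the univ road) — connectivity is a consequence of two laws the suppliers already display ((T) and the level-0 cover (G1′)); this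
file proves it once, so the consumers can drop the hypothesis by name.

WHAT IS PROVED (0 sorry; proof lane — no `def`; «chain-connected» is spelled `Relation.ReflTransGen` of the unit sup-step relation inside the set).
* §1 `eq_or_adj_of_near` — two blocks containing sites at sup-distance `≤ 1` are equal or adjacent; ★ `reachable_of_chain` — if the blocks cover `Ω₀`, a chain of
  unit sup-steps inside `Ω₀` from a site of block `u` to a site of block `v` makes `u`, `v` reachable; ★★ `preconnected_of_chainConnected` — laws (T) + level-0
  cover + `Ω₀` chain-connected ⟹ `∀ u v, (graphZd L x).Reachable u v` (`1 ≤ L`).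
* §2 `chain_inBox` — a box `{z | InBox lo hi z}` of `ℤᵈ` is chain-connected (coordinate-wise unit moves toward the target stay in the box; induction on the
  ℓ¹ distance); `chain_univ` — so is `ℤᵈ`.
* §3 ★★ `preconnected_of_box` — a member with `Ω₀ = {z | InBox lo hi z}`, laws (T) + level-0 cover, `1 ≤ L`: every two blocks are reachable;
  ★ `preconnected_of_univ` — the same for `Ω₀ = ℤᵈ`.
HONEST SCOPE.  Lattice combinatorics; (T) and the cover law DISPLAYED (their derivation for a concrete `ZdIdx` is the law owners'); nothing of [4]∕[B9] asserted.
Count-neutral; N05∕N06 NOT discharged; one finite lattice programme at fixed `ε`; R4 closes the conditional finite-𝕋⁴ rung `BalabanLadder.UV` only; nothing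
continuum ∕ ℝ⁴ ∕ OS ∕ mass-gap ∕ Clay.  Unit `pub-ymgap-dag-n06-w2` (g2), 2026-08-28.
-/

namespace Literature.MathematicalPhysics.QuantumFieldTheory.Balaban1983to89.B9GraphZdConnected

open B7Prop1Local (InBox)
open B8LeafModelZd (ZdIdx)
open B9SupplySockB9P3ZdFrame (MemberZd BSite blockZd Touch graphZd)
open B9Lemma21ShellCrossingZd (Omega_antitone blockZd_nonempty)

-- `Site` alone could resolve to the torus sites of `Setup.lean`; re-export the `ℤ^d` sites of `B7Prop1Explicit`.
export B7Prop1Explicit (Site)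

variable {d L : ℕ} {x : MemberZd d L}

/-! ## §1 Chains of sites give chains of blocks -/

/-- two blocks containing sites at sup-distance `≤ 1` are equal or adjacent in the block graph. [cite: Balaban1984PropagatorsII, (2.46) p.231 (admissible bonds)] -/
theorem eq_or_adj_of_near {u v : BSite L x} {z z' : Site d} (hz : z ∈ blockZd L u.1.1 u.1.2) (hz' : z' ∈ blockZd L v.1.1 v.1.2)
    (h : ∀ μ, |z μ - z' μ| ≤ 1) : u = v ∨ (graphZd L x).Adj u v := by
  by_cases huv : u = v
  · exact Or.inl huv
  · exact Or.inr ⟨huv, z, hz, z', hz', h⟩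

/-- ★ **A CHAIN OF UNIT SUP-STEPS INSIDE `Ω₀` FROM A SITE OF BLOCK `u` TO A SITE OF BLOCK `v` MAKES `u, v` REACHABLE** when every site of `Ω₀` lies in a block (the
level-0 cover law): each step stays inside one block or crosses an admissible bond. [cite: Balaban1984PropagatorsII, (2.46) p.231] -/
theorem reachable_of_chain (hcover : ∀ z ∈ x.i.Ω 0, ∃ y : BSite L x, z ∈ blockZd L y.1.1 y.1.2) {z z' : Site d}
    (h : Relation.ReflTransGen (fun a b : Site d => a ∈ x.i.Ω 0 ∧ b ∈ x.i.Ω 0 ∧ ∀ μ, |a μ - b μ| ≤ 1) z z')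
    {u : BSite L x} (hz : z ∈ blockZd L u.1.1 u.1.2) :
    ∀ {v : BSite L x}, z' ∈ blockZd L v.1.1 v.1.2 → (graphZd L x).Reachable u v := by
  induction h with
  | refl =>
    intro v hz'
    rcases eq_or_adj_of_near hz hz' (fun μ => by simp) with h | h
    · exact h ▸ SimpleGraph.Reachable.refl u
    · exact h.reachable
  | tail _ hbc ih =>
    intro v hz'
    obtain ⟨hb, _, hstep⟩ := hbc
    obtain ⟨w, hw⟩ := hcover _ hb
    have h1 : (graphZd L x).Reachable u w := ih hw
    rcases eq_or_adj_of_near hw hz' hstep with h | h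
    · exact h ▸ h1
    · exact h1.trans h.reachable

/-- ★★ **LAWS (T) + LEVEL-0 COVER + `Ω₀` CHAIN-CONNECTED ⟹ THE BLOCK GRAPH IS CONNECTED** (`1 ≤ L`: blocks are non-empty): every two blocks are joined by an admissible
contour — the hypothesis `hconn` of `B9Lemma21ShellCrossingZd.cube_exchange_of_connected`, `B9GraphZdBallGrowth.rowLetter_uniform_of_connected`, `B9Lemma21RowLetterZd`.
[cite: Balaban1984PropagatorsII, (2.46) p.231; Balaban1985BackgroundPropagators, p.397 (d(y, y′))] -/
theorem preconnected_of_chainConnected (hL : 1 ≤ L) (hT : ∀ y : BSite L x, blockZd L y.1.1 y.1.2 ⊆ x.i.Ω y.1.1)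
    (hcover : ∀ z ∈ x.i.Ω 0, ∃ y : BSite L x, z ∈ blockZd L y.1.1 y.1.2)
    (hΩ : ∀ z ∈ x.i.Ω 0, ∀ z' ∈ x.i.Ω 0,
      Relation.ReflTransGen (fun a b : Site d => a ∈ x.i.Ω 0 ∧ b ∈ x.i.Ω 0 ∧ ∀ μ, |a μ - b μ| ≤ 1) z z') :
    ∀ u v : BSite L x, (graphZd L x).Reachable u v := by
  intro u v
  obtain ⟨z, hz⟩ := blockZd_nonempty hL u.1.1 u.1.2
  obtain ⟨z', hz'⟩ := blockZd_nonempty hL v.1.1 v.1.2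
  have hz0 : z ∈ x.i.Ω 0 := Omega_antitone x.i (Nat.zero_le _) (hT u hz)
  have hz0' : z' ∈ x.i.Ω 0 := Omega_antitone x.i (Nat.zero_le _) (hT v hz')
  exact reachable_of_chain hcover (hΩ z hz0 z' hz0') hz hz'

/-! ## §2 Boxes and `ℤᵈ` are chain-connected -/

/-- **A BOX OF `ℤᵈ` IS CHAIN-CONNECTED THROUGH UNIT SUP-STEPS**: any two sites of `{z | InBox lo hi z}` are joined by a chain of sites of the box, consecutive ones at
sup-distance `≤ 1` (move one coordinate one unit toward the target; induction on the ℓ¹ distance). [cite: Balaban1984PropagatorsII, (2.46) p.231 (contours on the lattice)] -/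
theorem chain_inBox (lo hi : Site d) :
    ∀ n : ℕ, ∀ z z' : Site d, InBox lo hi z → InBox lo hi z' → (∑ μ, |z μ - z' μ|) ≤ n →
      Relation.ReflTransGen (fun a b : Site d => InBox lo hi a ∧ InBox lo hi b ∧ ∀ μ, |a μ - b μ| ≤ 1) z z' := by
  intro n
  induction n with
  | zero =>
    intro z z' _ _ hsum
    have h0 : ∀ μ, |z μ - z' μ| = 0 := by
      intro μ
      have h1 : |z μ - z' μ| ≤ ∑ ν, |z ν - z' ν| := Finset.single_le_sum (fun ν _ => abs_nonneg (z ν - z' ν)) (Finset.mem_univ μ)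
      have h2 : 0 ≤ |z μ - z' μ| := abs_nonneg _
      push_cast at hsum
      linarith
    have : z = z' := funext fun μ => by have := h0 μ; rw [abs_eq_zero] at this; linarith
    subst this
    exact Relation.ReflTransGen.refl
  | succ n ih =>
    intro z z' hz hz' hsum
    by_cases heq : z = z'
    · subst heq; exact Relation.ReflTransGen.refl
    · -- a coordinate where they differ; step one unit toward z'
      obtain ⟨μ, hμ⟩ : ∃ μ, z μ ≠ z' μ := by
        by_contra hall
        push Not at hall
        exact heq (funext hall)
      let s : ℤ := if z μ < z' μ then 1 else -1
      let z₁ : Site d := Function.update z μ (z μ + s)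
      have hs : |s| = 1 ∧ |z μ + s - z' μ| + 1 = |z μ - z' μ| := by
        by_cases hlt : z μ < z' μ
        · simp only [s, if_pos hlt]
          constructor
          · simp
          · rw [abs_of_nonpos (by omega), abs_of_neg (by omega)]; ring
        · simp only [s, if_neg hlt]
          have hgt : z' μ < z μ := lt_of_le_of_ne (not_lt.mp hlt) (Ne.symm hμ)
          constructor
          · simp
          · rw [abs_of_nonneg (by omega), abs_of_pos (by omega)]; ring
      have hz₁μ : z₁ μ = z μ + s := by simp [z₁]
      have hz₁ν : ∀ ν, ν ≠ μ → z₁ ν = z ν := fun ν hν => by simp [z₁, hν]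
      -- z₁ stays in the box
      have hz₁box : InBox lo hi z₁ := by
        intro ν
        by_cases hν : ν = μ
        · subst hν
          rw [hz₁μ]
          obtain ⟨h1, h2⟩ := hz ν
          obtain ⟨h1', h2'⟩ := hz' ν
          by_cases hlt : z ν < z' ν
          · simp only [s, if_pos hlt]; constructor <;> omega
          · simp only [s, if_neg hlt]
            have hgt : z' ν < z ν := lt_of_le_of_ne (not_lt.mp hlt) (Ne.symm hμ)
            constructor <;> omega
        · rw [hz₁ν ν hν]; exact hz ν
      -- one unit step
      have hstep : ∀ ν, |z ν - z₁ ν| ≤ 1 := by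
        intro ν
        by_cases hν : ν = μ
        · subst hν; rw [hz₁μ]
          have : z ν - (z ν + s) = -s := by ring
          rw [this, abs_neg, hs.1]
        · rw [hz₁ν ν hν, sub_self, abs_zero]; exact zero_le_one
      -- the ℓ¹ distance drops by one
      have hsum₁ : (∑ ν, |z₁ ν - z' ν|) ≤ n := by
        have hsplit : ∀ w : Site d, (∑ ν, |w ν - z' ν|) = |w μ - z' μ| + ∑ ν ∈ Finset.univ.erase μ, |w ν - z' ν| := fun w =>
          (Finset.add_sum_erase Finset.univ (fun ν => |w ν - z' ν|) (Finset.mem_univ μ)).symm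
        have hrest : ∑ ν ∈ Finset.univ.erase μ, |z₁ ν - z' ν| = ∑ ν ∈ Finset.univ.erase μ, |z ν - z' ν| :=
          Finset.sum_congr rfl fun ν hν => by rw [hz₁ν ν (Finset.ne_of_mem_erase hν)]
        rw [hsplit z₁, hrest, hz₁μ]
        have := hsplit z
        rw [this] at hsum
        push_cast at hsum ⊢
        linarith [hs.2]
      have htail := ih z₁ z' hz₁box hz' hsum₁
      exact Relation.ReflTransGen.head ⟨hz, hz₁box, hstep⟩ htail

/-- **`ℤᵈ` IS CHAIN-CONNECTED** through unit sup-steps (the box argument without walls). [cite: Balaban1984PropagatorsII, (2.46) p.231 (contours on the lattice)] -/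
theorem chain_univ (z z' : Site d) :
    Relation.ReflTransGen (fun a b : Site d => a ∈ (Set.univ : Set (Site d)) ∧ b ∈ (Set.univ : Set (Site d)) ∧ ∀ μ, |a μ - b μ| ≤ 1) z z' := by
  -- the box spanned by z and z'
  let lo : Site d := fun μ => min (z μ) (z' μ)
  let hi : Site d := fun μ => max (z μ) (z' μ)
  have hz : InBox lo hi z := fun μ => ⟨min_le_left _ _, le_max_left _ _⟩
  have hz' : InBox lo hi z' := fun μ => ⟨min_le_right _ _, le_max_right _ _⟩
  obtain ⟨n, hn⟩ : ∃ n : ℕ, (∑ μ, |z μ - z' μ|) ≤ n :=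
    ⟨(∑ μ, |z μ - z' μ|).toNat, Int.self_le_toNat _⟩
  have h := chain_inBox lo hi n z z' hz hz' hn
  exact Relation.ReflTransGen.mono (p := fun a b : Site d => a ∈ (Set.univ : Set (Site d)) ∧ b ∈ (Set.univ : Set (Site d)) ∧ ∀ μ, |a μ - b μ| ≤ 1)
    (fun a b hab => ⟨Set.mem_univ a, Set.mem_univ b, hab.2.2⟩) z z' h

/-! ## §3 Members with a box or all of `ℤᵈ` as `Ω₀` -/

/-- ★★ **A MEMBER WHOSE `Ω₀` IS A BOX HAS A CONNECTED BLOCK GRAPH** (laws (T) + level-0 cover, `1 ≤ L`): `∀ u v, (graphZd L x).Reachable u v` — the connectivity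
hypothesis of the (2.60)∕(2.61) files, discharged for the finite road's members. [cite: Balaban1984PropagatorsII, (2.46) p.231, (2.1) p.224 (the domains); Balaban1985BackgroundPropagators, p.397] -/
theorem preconnected_of_box (hL : 1 ≤ L) (hT : ∀ y : BSite L x, blockZd L y.1.1 y.1.2 ⊆ x.i.Ω y.1.1)
    (hcover : ∀ z ∈ x.i.Ω 0, ∃ y : BSite L x, z ∈ blockZd L y.1.1 y.1.2)
    {lo hi : Site d} (hbox : x.i.Ω 0 = {z | InBox lo hi z}) :
    ∀ u v : BSite L x, (graphZd L x).Reachable u v := by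
  refine preconnected_of_chainConnected hL hT hcover fun z hz z' hz' => ?_
  rw [hbox] at hz hz'
  obtain ⟨n, hn⟩ : ∃ n : ℕ, (∑ μ, |z μ - z' μ|) ≤ n :=
    ⟨(∑ μ, |z μ - z' μ|).toNat, Int.self_le_toNat _⟩
  have h := chain_inBox lo hi n z z' hz hz' hn
  rw [hbox]
  exact Relation.ReflTransGen.mono (p := fun a b : Site d => a ∈ {z | InBox lo hi z} ∧ b ∈ {z | InBox lo hi z} ∧ ∀ μ, |a μ - b μ| ≤ 1)
    (fun a b hab => hab) z z' h

/-- ★ **A MEMBER WITH `Ω₀ = ℤᵈ` HAS A CONNECTED BLOCK GRAPH** (laws (T) + level-0 cover, `1 ≤ L`) — the univ road's members. [cite: Balaban1984PropagatorsII, (2.46) p.231; Balaban1985BackgroundPropagators, p.397] -/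
theorem preconnected_of_univ (hL : 1 ≤ L) (hT : ∀ y : BSite L x, blockZd L y.1.1 y.1.2 ⊆ x.i.Ω y.1.1)
    (hcover : ∀ z ∈ x.i.Ω 0, ∃ y : BSite L x, z ∈ blockZd L y.1.1 y.1.2) (huniv : x.i.Ω 0 = Set.univ) :
    ∀ u v : BSite L x, (graphZd L x).Reachable u v := by
  refine preconnected_of_chainConnected hL hT hcover fun z _ z' _ => ?_
  have h := chain_univ z z'
  rw [huniv]
  exact h

end Literature.MathematicalPhysics.QuantumFieldTheory.Balaban1983to89.B9GraphZdConnected
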